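import Literature.NumberTheory.LFunctions.RiemannSiegelStirling
import Literature.Analysis.SpecialFunctions.LogSumTrapezoid
import Mathlib.Analysis.SpecialFunctions.Stirling
import Mathlib.Analysis.SpecialFunctions.Complex.LogBounds
import HarnessLib

/-!
# Stirling's formula for `|Γ(w)|`, uniformly on the right half-plane, with an explicit error

Topic `Literature/Analysis/SpecialFunctions` (companion of `DigammaGauss.lean`,
`GammaStirlingOrder.lean`, `LogGammaStirlingLower.lean`). Everything here is PROVED; there are no
definitions and no named facts.

Mathlib has Stirling's formula for `n!` (`Stirling.tendsto_stirlingSeq_sqrt_pi`) but no form of it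
for the complex `Γ`-function; the tree so far had two-sided bounds of Stirling *order* on bounded
vertical strips (`GammaStirlingOrder.lean`), vertical-line expansions of `Re ψ`, `Im ψ`, `arg Γ`
with errors in `1/|Im w|` (`DigammaGauss.lean`,
`Literature/NumberTheory/LFunctions/RiemannSiegelStirling.lean`),
and a real-axis lower bound (`LogGammaStirlingLower.lean`). This file proves the genuine first-order
Stirling formula for the MODULUS, uniformly on `Re w > 0` (in particular up to the real axis and for
unbounded real part), with an explicit remainder:

* `Literature.Analysis.SpecialFunctions.GammaStirling.abs_log_norm_Gamma_sub_le` — for `0 < Re w`,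

    `|log |Γ(w)| − ((Re w − ½) log |w| − Im w · Arg w − Re w + ½ log 2π)|`
    `  ≤ (1/12)(1/|w|² + π/(2|w|))`,

  i.e. `|Γ(w)| = √(2π) |w^{w − ½}| e^{−Re w} e^{O(1/|w|)}` with `|O(1/|w|)| ≤ 0.215/|w|` for
  `|w| ≥ 1`
  (Whittaker–Watson §12.33, §13.6; Titchmarsh, *Theory of Functions*, §4.42, where the remainder is
  Binet's `|μ(w)| ≤ 1/(12|w| cos²(½ arg w))`).

## Proof

Euler's limit formula `Γ(w) = lim n^w n!/∏_{j ≤ n}(w + j)` (Mathlib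
`Complex.GammaSeq_tendsto_Gamma`) in logarithmic form,
`log |GammaSeq w n| = Re w log n + log n! − Σ_{j ≤ n} log |w + j|` (`log_norm_GammaSeq`); the `C²`
trapezoid rule (`Literature.Analysis.Calculus.norm_integral_sub_trapezoid_le`) for
`g(u) = log |w + u|` on each `[k, k+1]`, `|g''| = |Re (w+u)^{−2}| ≤ 1/|w+k|²`
(`abs_trapezoid_log_norm_le`), summed with `Σ_k 1/|w+k|² ≤ 1/|w|² + π/(2|w|)`
(`sum_inv_norm_add_sq_le`, this is where `Re w > 0` enters: `|w + u|² ≥ u² + |w|²`); the closed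
form `∫₀ⁿ log|w+u| du = Re[L(w+n) − L(w)]`, `L(z) = z log z − z` (`integral_log_norm_add`);
Stirling for `n!`; and the limits `n log(1 + w/n) → w` (Mathlib
`Complex.tendsto_nat_mul_log_one_add_of_tendsto`), `log n − log|w + n| → 0`.

Small helpers (`hasDerivAt_one_div_add_ofReal`, `hasDerivAt_re_comp`, `norm_add_ofReal_mono`,
`sum_range_succ_eq_sum_trapezoid`) are reused from `RiemannSiegelStirling.lean`, and
(`re_one_div_add_ofReal`, `norm_add_ofReal_sq`, `integral_inv_sq_add_sq_le`,
`tendsto_log_nat_sub_log_norm_add`) from `DigammaGauss.lean`.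

Deliberately NOT here: the argument `arg Γ(w)` (see `RiemannSiegelStirling.lean` on vertical lines),
higher terms of Stirling's series, sectors beyond the right half-plane.

## References

* E. T. Whittaker, G. N. Watson, *A Course of Modern Analysis*, 4th ed. (1927), §12.33, §13.6.
* E. C. Titchmarsh, *The Theory of Functions*, 2nd ed. (1939), §4.42.
-/

noncomputable section

open Complex Real Set Filter Topology MeasureTheory intervalIntegral Finset
open scoped Nat

open Literature.Analysis.SpecialFunctions.Complex (re_one_div_add_ofReal norm_add_ofReal_sq
  norm_add_ofReal_pos integral_inv_sq_add_sq_le tendsto_log_nat_sub_log_norm_add)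
open Literature.NumberTheory.LFunctions.Complex (hasDerivAt_one_div_add_ofReal hasDerivAt_re_comp
  norm_add_ofReal_mono sum_range_succ_eq_sum_trapezoid)

namespace Literature.Analysis.SpecialFunctions

namespace GammaStirling

/-! ### The kernel `u ↦ log ‖w + u‖` and its first two derivatives along the reals -/

/-- `w + u ≠ 0` for `0 < Re w`, `0 ≤ u`. [folklore] -/
lemma add_ofReal_ne_zero {w : ℂ} (hw : 0 < w.re) {u : ℝ} (hu : 0 ≤ u) : w + u ≠ 0 :=
  norm_pos_iff.1 (norm_add_ofReal_pos hw hu)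

/-- `w + u` lies in the slit plane for `0 < Re w`, `0 ≤ u`. [folklore] -/
lemma add_ofReal_mem_slitPlane {w : ℂ} (hw : 0 < w.re) {u : ℝ} (hu : 0 ≤ u) :
    w + u ∈ slitPlane := Or.inl (by simp; linarith)

/-- `log ‖w + u‖ = ½ log((Re w + u)² + (Im w)²)`. [folklore] -/
lemma log_norm_add_ofReal (w : ℂ) (u : ℝ) :
    Real.log ‖w + u‖ = (1 / 2) * Real.log ((w.re + u) ^ 2 + w.im ^ 2) := by
  rw [← norm_add_ofReal_sq, Real.log_pow]; ring

/-- `d/du log ‖w + u‖ = Re 1/(w+u)` (`0 < Re w`, `0 ≤ u`). [folklore] -/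
lemma hasDerivAt_log_norm_add {w : ℂ} (hw : 0 < w.re) {u : ℝ} (hu : 0 ≤ u) :
    HasDerivAt (fun u : ℝ ↦ Real.log ‖w + u‖) ((1 / (w + u)).re) u := by
  have hfun : (fun u : ℝ ↦ Real.log ‖w + u‖) =
      fun u ↦ (1 / 2) * Real.log ((w.re + u) ^ 2 + w.im ^ 2) := funext (log_norm_add_ofReal w)
  rw [hfun]
  have hpos : 0 < (w.re + u) ^ 2 + w.im ^ 2 := by
    rw [← norm_add_ofReal_sq]; exact pow_pos (norm_add_ofReal_pos hw hu) 2
  have h1 : HasDerivAt (fun u : ℝ ↦ (w.re + u) ^ 2 + w.im ^ 2) (2 * (w.re + u)) u := by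
    have := ((hasDerivAt_id u).const_add w.re).pow 2
    simpa using this.add_const (w.im ^ 2)
  have h2 := (h1.log hpos.ne').const_mul (1 / 2)
  refine h2.congr_deriv ?_
  rw [re_one_div_add_ofReal]
  field_simp

/-- **Trapezoid error on one unit interval** for `g(u) = log ‖w + u‖`: for `0 < Re w`, `0 ≤ k`,
`|∫ₖ^{k+1} g − (g k + g (k+1))/2| ≤ 1/(12 ‖w + k‖²)` (`|g''| = |Re 1/(w+u)²| ≤ 1/‖w+k‖²` on
`[k, k+1]`, and the `C²` trapezoid bound
`Literature.Analysis.Calculus.norm_integral_sub_trapezoid_le`). [folklore] -/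
lemma abs_trapezoid_log_norm_le {w : ℂ} (hw : 0 < w.re) {k : ℝ} (hk : 0 ≤ k) :
    |(∫ u in k..(k + 1), Real.log ‖w + u‖) -
        (Real.log ‖w + k‖ + Real.log ‖w + (k + 1 : ℝ)‖) / 2| ≤ 1 / (12 * ‖w + k‖ ^ 2) := by
  have hpos : 0 < ‖w + k‖ := norm_add_ofReal_pos hw hk
  have hmem : ∀ x ∈ Icc k (k + 1), 0 ≤ x := fun x hx ↦ hk.trans hx.1
  have h := Literature.Analysis.Calculus.norm_integral_sub_trapezoid_le (E := ℝ)
    (f := fun u : ℝ ↦ Real.log ‖w + u‖) (f' := fun u : ℝ ↦ (1 / (w + u)).re)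
    (f'' := fun u : ℝ ↦ (-1 / (w + u) ^ 2).re) (a := k) (b := k + 1) (ζ := 1 / ‖w + k‖ ^ 2)
    (by linarith) (fun x hx ↦ hasDerivAt_log_norm_add hw (hmem x hx))
    (fun x hx ↦ hasDerivAt_re_comp
      (hasDerivAt_one_div_add_ofReal (add_ofReal_ne_zero hw (hmem x hx))))
    ?_ ?_
  · have e1 : (k + 1 - k) = (1 : ℝ) := by ring
    rw [e1] at h
    norm_num at h
    have e2 : 1 / (12 * ‖w + k‖ ^ 2) = (‖w + k‖ ^ 2)⁻¹ / 12 := by field_simp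
    rw [e2]
    convert h using 3
    push_cast
    ring
  · -- continuity of `f''` on `[k, k+1]`
    refine continuous_re.comp_continuousOn (ContinuousOn.div continuousOn_const (by fun_prop) ?_)
    intro x hx
    exact pow_ne_zero 2 (add_ofReal_ne_zero hw (hmem x hx))
  · intro x hx
    have hxk : ‖w + k‖ ≤ ‖w + x‖ := norm_add_ofReal_mono hw hk hx.1
    have hx0 : 0 < ‖w + x‖ := hpos.trans_le hxk
    rw [Real.norm_eq_abs]
    calc |(-1 / (w + x) ^ 2).re| ≤ ‖-1 / (w + x) ^ 2‖ := abs_re_le_norm _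
      _ = 1 / ‖w + x‖ ^ 2 := by simp [norm_pow]
      _ ≤ 1 / ‖w + k‖ ^ 2 := by
        apply div_le_div_of_nonneg_left zero_le_one (by positivity)
        exact pow_le_pow_left₀ hpos.le hxk 2

/-- `Σ_{j<n} 1/‖w+j‖² ≤ 1/‖w‖² + π/(2‖w‖)` for `0 < Re w` (compare the terms `j ≥ 1` with
`∫₀^∞ du/(u² + ‖w‖²) = π/(2‖w‖)`, using `‖w + u‖² ≥ u² + ‖w‖²`). [folklore] -/
lemma sum_inv_norm_add_sq_le {w : ℂ} (hw : 0 < w.re) (n : ℕ) :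
    ∑ j ∈ Finset.range n, 1 / ‖w + j‖ ^ 2 ≤ 1 / ‖w‖ ^ 2 + π / (2 * ‖w‖) := by
  have hw0 : 0 < ‖w‖ := by
    have := norm_add_ofReal_pos hw le_rfl
    simpa using this
  rcases Nat.eq_zero_or_pos n with rfl | hn
  · simp only [Finset.range_zero, Finset.sum_empty]
    positivity
  obtain ⟨m, rfl⟩ : ∃ m, n = m + 1 := ⟨n - 1, by omega⟩
  rw [Finset.sum_range_succ']
  simp only [Nat.cast_add, Nat.cast_one, CharP.cast_eq_zero, add_zero]
  rw [add_comm]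
  gcongr
  set f : ℝ → ℝ := fun u ↦ 1 / (u ^ 2 + ‖w‖ ^ 2) with hf
  have hterm : ∀ i ∈ Finset.range m, 1 / ‖w + ((i : ℂ) + 1)‖ ^ 2 ≤ f ((i + 1 : ℕ) : ℝ) := by
    intro i _
    have hcast : w + ((i : ℂ) + 1) = w + (((i : ℝ) + 1 : ℝ) : ℂ) := by push_cast; ring
    rw [hcast, norm_add_ofReal_sq, hf]
    push_cast
    have h0 : 0 ≤ (i : ℝ) + 1 := by positivity
    have hpos : 0 < ((i : ℝ) + 1) ^ 2 + ‖w‖ ^ 2 := by positivity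
    apply one_div_le_one_div_of_le hpos
    have hn2 : ‖w‖ ^ 2 = w.re ^ 2 + w.im ^ 2 := by
      rw [Complex.sq_norm, Complex.normSq_apply]; ring
    rw [hn2]
    nlinarith [hw.le]
  have hanti : AntitoneOn f (Icc (0 : ℕ) (m : ℕ)) := by
    intro u hu v hv huv
    simp only [hf]
    have hu0 : (0 : ℝ) ≤ u := by exact_mod_cast hu.1
    have hpos : 0 < u ^ 2 + ‖w‖ ^ 2 := by positivity
    gcongr
  calc ∑ i ∈ Finset.range m, 1 / ‖w + ((i : ℂ) + 1)‖ ^ 2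
      ≤ ∑ i ∈ Finset.range m, f ((i + 1 : ℕ) : ℝ) := Finset.sum_le_sum hterm
    _ = ∑ i ∈ Finset.Ico 0 m, f ((i + 1 : ℕ) : ℝ) := by rw [Finset.range_eq_Ico]
    _ ≤ ∫ u in ((0 : ℕ) : ℝ)..((m : ℕ) : ℝ), f u :=
        AntitoneOn.sum_le_integral_Ico (Nat.zero_le m) hanti
    _ ≤ π / (2 * ‖w‖) := by
        have := integral_inv_sq_add_sq_le (y := ‖w‖) hw0.ne' (Nat.cast_nonneg m)
        rw [abs_of_pos hw0] at this
        simpa [hf] using this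


/-! ### Bookkeeping: the trapezoid decomposition and the closed-form integral -/

/-- The primitive: `d/du Re[(w+u) log(w+u) − (w+u)] = log ‖w+u‖` (`0 < Re w`, `0 ≤ u`).
[folklore] -/
lemma hasDerivAt_re_primitive_log {w : ℂ} (hw : 0 < w.re) {u : ℝ} (hu : 0 ≤ u) :
    HasDerivAt (fun u : ℝ ↦ ((w + u) * Complex.log (w + u) - (w + u)).re) (Real.log ‖w + u‖) u := by
  have h : HasDerivAt (fun z : ℂ ↦ (w + z) * Complex.log (w + z) - (w + z))
      (Complex.log (w + u) * 1) (u : ℂ) :=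
    (Literature.Analysis.SpecialFunctions.hasDerivAt_mul_log_sub_self
      (add_ofReal_mem_slitPlane hw hu)).comp (u : ℂ) ((hasDerivAt_id (u : ℂ)).const_add w)
  have h2 := hasDerivAt_re_comp h.comp_ofReal
  simpa [Complex.log_re] using h2

/-- `∫ₐᵇ log ‖w+u‖ du = Re L(w+b) − Re L(w+a)` with `L(z) = z log z − z` (`0 < Re w`, `0 ≤ a, b`).
[folklore] -/
lemma integral_log_norm_add {w : ℂ} (hw : 0 < w.re) {a b : ℝ} (ha : 0 ≤ a) (hb : 0 ≤ b) :
    ∫ u in a..b, Real.log ‖w + u‖ =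
      ((w + b) * Complex.log (w + b) - (w + b)).re -
        ((w + a) * Complex.log (w + a) - (w + a)).re := by
  have hmem : ∀ u ∈ uIcc a b, 0 ≤ u := fun u hu ↦ by
    rcases mem_uIcc.1 hu with h | h <;> linarith [h.1]
  refine integral_eq_sub_of_hasDerivAt (fun u hu ↦ hasDerivAt_re_primitive_log hw (hmem u hu)) ?_
  refine ContinuousOn.intervalIntegrable fun u hu ↦ ?_
  exact (hasDerivAt_log_norm_add hw (hmem u hu)).continuousAt.continuousWithinAt

/-- `log ‖GammaSeq w n‖ = Re w · log n + log n! − Σ_{j ≤ n} log ‖w + j‖` (`n ≥ 1`, `0 < Re w`):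
Euler's sequence `n^w n!/∏_{j ≤ n}(w + j)` in logarithmic form. [folklore] -/
lemma log_norm_GammaSeq {w : ℂ} (hw : 0 < w.re) {n : ℕ} (hn : n ≠ 0) :
    Real.log ‖Complex.GammaSeq w n‖ =
      w.re * Real.log n + Real.log (n ! : ℝ) -
        ∑ j ∈ Finset.range (n + 1), Real.log ‖w + ((j : ℝ) : ℂ)‖ := by
  have hn0 : (0 : ℝ) < n := Nat.cast_pos.2 (Nat.pos_of_ne_zero hn)
  have hfac : (0 : ℝ) < (n ! : ℝ) := Nat.cast_pos.2 (Nat.factorial_pos n)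
  have hterm : ∀ j ∈ Finset.range (n + 1), ‖w + ((j : ℝ) : ℂ)‖ ≠ 0 := fun j _ ↦
    (norm_add_ofReal_pos hw (Nat.cast_nonneg j)).ne'
  have hP : 0 < ∏ j ∈ Finset.range (n + 1), ‖w + ((j : ℝ) : ℂ)‖ :=
    Finset.prod_pos fun j _ ↦ norm_add_ofReal_pos hw (Nat.cast_nonneg j)
  have hcast : ∏ j ∈ Finset.range (n + 1), (w + (j : ℂ)) =
      ∏ j ∈ Finset.range (n + 1), (w + ((j : ℝ) : ℂ)) := by
    simp only [Complex.ofReal_natCast]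
  rw [Complex.GammaSeq, hcast, norm_div, norm_mul, Complex.norm_natCast_cpow_of_pos
    (Nat.pos_of_ne_zero hn), Complex.norm_natCast, norm_prod,
    Real.log_div (mul_pos (Real.rpow_pos_of_pos hn0 _) hfac).ne' hP.ne',
    Real.log_mul (Real.rpow_pos_of_pos hn0 _).ne' hfac.ne', Real.log_rpow hn0,
    Real.log_prod (fun j hj ↦ hterm j hj)]

/-- **The total trapezoid error.** For `0 < Re w` and `n : ℕ`,
`|Σ_{j ≤ n} log‖w+j‖ − ∫₀ⁿ log‖w+u‖ du − (log‖w‖ + log‖w+n‖)/2| ≤ (1/12)(1/‖w‖² + π/(2‖w‖))`.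
[folklore] -/
lemma abs_sum_log_norm_sub_integral_le {w : ℂ} (hw : 0 < w.re) (n : ℕ) :
    |∑ j ∈ Finset.range (n + 1), Real.log ‖w + ((j : ℝ) : ℂ)‖ -
        (∫ u in (0 : ℝ)..n, Real.log ‖w + u‖) -
        (Real.log ‖w‖ + Real.log ‖w + ((n : ℝ) : ℂ)‖) / 2| ≤
      (1 / 12) * (1 / ‖w‖ ^ 2 + π / (2 * ‖w‖)) := by
  set g : ℝ → ℝ := fun u ↦ Real.log ‖w + u‖ with hg
  have hint : ∀ k < n, IntervalIntegrable g volume (k : ℕ) ((k + 1 : ℕ) : ℝ) := by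
    intro k _
    refine ContinuousOn.intervalIntegrable fun u hu ↦ ?_
    have hu0 : 0 ≤ u := by
      rcases mem_uIcc.1 hu with h | h
      · exact (Nat.cast_nonneg k).trans h.1
      · exact (Nat.cast_nonneg (k + 1)).trans h.1
    exact (hasDerivAt_log_norm_add hw hu0).continuousAt.continuousWithinAt
  have hsum : ∫ u in (0 : ℝ)..n, g u =
      ∑ k ∈ Finset.range n, ∫ u in (k : ℕ)..((k + 1 : ℕ) : ℝ), g u := by
    rw [intervalIntegral.sum_integral_adjacent_intervals hint, Nat.cast_zero]
  have htrap := sum_range_succ_eq_sum_trapezoid (fun j ↦ g j) n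
  have hg0 : g 0 = Real.log ‖w‖ := by simp [hg]
  have hrew : ∑ j ∈ Finset.range (n + 1), g j - (∫ u in (0 : ℝ)..n, g u) - (g 0 + g n) / 2 =
      -∑ k ∈ Finset.range n,
        ((∫ u in (k : ℕ)..((k + 1 : ℕ) : ℝ), g u) - (g k + g ((k + 1 : ℕ) : ℝ)) / 2) := by
    rw [htrap, hsum, Finset.sum_sub_distrib]
    ring
  simp only [hg] at hrew hg0
  rw [← hg0, hrew, abs_neg]
  calc |∑ k ∈ Finset.range n, ((∫ u in (k : ℕ)..((k + 1 : ℕ) : ℝ), Real.log ‖w + u‖) -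
          (Real.log ‖w + ((k : ℕ) : ℝ)‖ + Real.log ‖w + (((k + 1 : ℕ) : ℝ) : ℂ)‖) / 2)|
      ≤ ∑ k ∈ Finset.range n, |(∫ u in (k : ℕ)..((k + 1 : ℕ) : ℝ), Real.log ‖w + u‖) -
          (Real.log ‖w + ((k : ℕ) : ℝ)‖ + Real.log ‖w + (((k + 1 : ℕ) : ℝ) : ℂ)‖) / 2| :=
        Finset.abs_sum_le_sum_abs _ _
    _ ≤ ∑ k ∈ Finset.range n, 1 / (12 * ‖w + k‖ ^ 2) := by
        refine Finset.sum_le_sum fun k _ ↦ ?_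
        have := abs_trapezoid_log_norm_le hw (Nat.cast_nonneg k)
        push_cast at this ⊢
        exact this
    _ = (1 / 12) * ∑ k ∈ Finset.range n, 1 / ‖w + k‖ ^ 2 := by
        rw [Finset.mul_sum]
        refine Finset.sum_congr rfl fun k _ ↦ ?_
        ring
    _ ≤ (1 / 12) * (1 / ‖w‖ ^ 2 + π / (2 * ‖w‖)) := by
        gcongr
        exact sum_inv_norm_add_sq_le hw n

/-! ### The uniform Stirling formula for `log ‖Γ(w)‖` on the right half-plane -/

/-- **Stirling's formula for `|Γ(w)|`, uniformly on `Re w > 0`, with an explicit error.**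
For `0 < Re w`:
`|log ‖Γ(w)‖ − ((Re w − ½) log ‖w‖ − Im w · Arg w − Re w + ½ log 2π)| ≤ (1/12)(1/‖w‖² + π/(2‖w‖))`.
(The main term is `Re[(w − ½) Log w − w] + ½ log 2π`.) Proof: Euler's limit formula
`Γ(w) = lim n^w n!/∏_{j≤n}(w+j)` (`Complex.GammaSeq_tendsto_Gamma`) in logarithmic form, the
trapezoid rule for `Σ_{j ≤ n} log ‖w + j‖` (`abs_sum_log_norm_sub_integral_le`) with
`∫₀ⁿ log‖w+u‖ du = Re[L(w+n) − L(w)]`, `L(z) = z log z − z`, Stirling's formula for `n!`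
(`Stirling.tendsto_stirlingSeq_sqrt_pi`) and `n log(1 + w/n) → w`. Whittaker–Watson §12.33,
§13.6; Titchmarsh, *Theory of Functions* §4.42. [folklore] -/
theorem abs_log_norm_Gamma_sub_le {w : ℂ} (hw : 0 < w.re) :
    |Real.log ‖Complex.Gamma w‖ -
        ((w.re - 1 / 2) * Real.log ‖w‖ - w.im * Complex.arg w - w.re + Real.log (2 * π) / 2)| ≤
      (1 / 12) * (1 / ‖w‖ ^ 2 + π / (2 * ‖w‖)) := by
  set B : ℝ := (1 / 12) * (1 / ‖w‖ ^ 2 + π / (2 * ‖w‖)) with hB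
  set M : ℝ := (w.re - 1 / 2) * Real.log ‖w‖ - w.im * Complex.arg w - w.re + Real.log (2 * π) / 2
    with hM
  -- `L n = log ‖GammaSeq w n‖ → log ‖Γ w‖`
  have hΓ : Complex.Gamma w ≠ 0 := Complex.Gamma_ne_zero_of_re_pos hw
  have hL : Tendsto (fun n : ℕ ↦ Real.log ‖Complex.GammaSeq w n‖) atTop
      (𝓝 (Real.log ‖Complex.Gamma w‖)) :=
    (Real.continuousAt_log (norm_ne_zero_iff.2 hΓ)).tendsto.comp
      ((continuous_norm.tendsto _).comp (Complex.GammaSeq_tendsto_Gamma w))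
  -- the three vanishing pieces of `D n`
  have hD1 : Tendsto (fun n : ℕ ↦ Real.log (Stirling.stirlingSeq n) - Real.log π / 2) atTop
      (𝓝 0) := by
    have h1 : Tendsto (fun n : ℕ ↦ Real.log (Stirling.stirlingSeq n)) atTop
        (𝓝 (Real.log (Real.sqrt π))) :=
      (Real.continuousAt_log (Real.sqrt_pos.2 Real.pi_pos).ne').tendsto.comp
        Stirling.tendsto_stirlingSeq_sqrt_pi
    rw [Real.log_sqrt Real.pi_pos.le] at h1
    simpa using h1.sub_const (Real.log π / 2)
  have hD2 : Tendsto (fun n : ℕ ↦ ((w + n) * Complex.log (w + n)).re - (w.re + n) * Real.log n -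
      w.re) atTop (𝓝 0) := by
    have h1 : Tendsto (fun n : ℕ ↦ (n : ℂ) * Complex.log (1 + w / n)) atTop (𝓝 w) := by
      apply Complex.tendsto_nat_mul_log_one_add_of_tendsto
      apply tendsto_nhds_of_eventually_eq
      filter_upwards [eventually_ne_atTop 0] with n hn
      field_simp
    have h3 : Tendsto (fun n : ℕ ↦ 1 + w / n) atTop (𝓝 1) := by
      simpa using (tendsto_const_div_atTop_nhds_zero_nat w).const_add 1
    have h2 : Tendsto (fun n : ℕ ↦ w * Complex.log (1 + w / n)) atTop (𝓝 0) := by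
      have h4 : Tendsto (fun n : ℕ ↦ Complex.log (1 + w / n)) atTop (𝓝 0) := by
        have := (continuousAt_clog (by simp : (1 : ℂ) ∈ slitPlane)).tendsto.comp h3
        simpa [Function.comp_def] using this
      simpa using h4.const_mul w
    have h5 : Tendsto (fun n : ℕ ↦ ((w + n) * Complex.log (1 + w / n)).re - w.re) atTop (𝓝 0) := by
      have h6 := (continuous_re.tendsto _).comp (h2.add h1)
      rw [zero_add] at h6
      have h7 : Tendsto (fun n : ℕ ↦ ((w + n) * Complex.log (1 + w / n)).re) atTop (𝓝 w.re) := by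
        refine h6.congr fun n ↦ ?_
        simp only [Function.comp_apply]
        congr 1
        ring
      simpa using h7.sub_const w.re
    refine h5.congr' ?_
    filter_upwards [eventually_ne_atTop 0] with n hn
    have hn0 : (0 : ℝ) < n := Nat.cast_pos.2 (Nat.pos_of_ne_zero hn)
    have hne : 1 + w / n ≠ 0 := by
      intro h0
      have h1 := congrArg Complex.re h0
      simp at h1
      have : 0 < 1 + w.re / n := by positivity
      linarith
    have hlog : Complex.log (w + n) = Real.log n + Complex.log (1 + w / n) := by
      have e : w + n = (n : ℝ) * (1 + w / n) := by
        have hn' : (n : ℂ) ≠ 0 := Nat.cast_ne_zero.2 hn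
        push_cast
        field_simp
        ring
      rw [e, Complex.log_ofReal_mul hn0 hne]
    rw [hlog, mul_add, Complex.add_re, Complex.re_mul_ofReal]
    simp only [Complex.add_re, Complex.natCast_re]
    ring
  have hD3 : Tendsto (fun n : ℕ ↦ Real.log ‖w + n‖ - Real.log n) atTop (𝓝 0) := by
    simpa using (tendsto_log_nat_sub_log_norm_add w).neg
  -- `D n → 0`
  set D : ℕ → ℝ := fun n ↦ (Real.log (Stirling.stirlingSeq n) - Real.log π / 2) -
    (((w + n) * Complex.log (w + n)).re - (w.re + n) * Real.log n - w.re) -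
    (1 / 2) * (Real.log ‖w + n‖ - Real.log n) with hD
  have hDlim : Tendsto D atTop (𝓝 0) := by
    have := (hD1.sub hD2).sub (hD3.const_mul (1 / 2))
    simpa [hD] using this
  -- the key identity `L n − M − D n = −T n` for `n ≥ 1`
  have hkey : ∀ n : ℕ, n ≠ 0 →
      Real.log ‖Complex.GammaSeq w n‖ - M - D n =
        -(∑ j ∈ Finset.range (n + 1), Real.log ‖w + ((j : ℝ) : ℂ)‖ -
          (∫ u in (0 : ℝ)..n, Real.log ‖w + u‖) -
          (Real.log ‖w‖ + Real.log ‖w + ((n : ℝ) : ℂ)‖) / 2) := by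
    intro n hn
    have hn0 : (0 : ℝ) < n := Nat.cast_pos.2 (Nat.pos_of_ne_zero hn)
    rw [log_norm_GammaSeq hw hn, integral_log_norm_add hw le_rfl hn0.le]
    have hfact : Real.log (n ! : ℝ) = Real.log (Stirling.stirlingSeq n) + 1 / 2 * Real.log 2 +
        1 / 2 * Real.log n + n * Real.log n - n := by
      rw [Stirling.log_stirlingSeq_formula, Real.log_mul two_ne_zero hn0.ne',
        Real.log_div hn0.ne' (Real.exp_pos 1).ne', Real.log_exp]
      ring
    have h2π : Real.log (2 * π) = Real.log 2 + Real.log π :=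
      Real.log_mul two_ne_zero Real.pi_pos.ne'
    have hP0 : ((w + ((0 : ℝ) : ℂ)) * Complex.log (w + ((0 : ℝ) : ℂ)) - (w + ((0 : ℝ) : ℂ))).re =
        w.re * Real.log ‖w‖ - w.im * Complex.arg w - w.re := by
      simp only [Complex.ofReal_zero, add_zero, Complex.sub_re, Complex.mul_re, Complex.log_re,
        Complex.log_im]
    have hPn : ((w + ((n : ℝ) : ℂ)) * Complex.log (w + ((n : ℝ) : ℂ)) - (w + ((n : ℝ) : ℂ))).re =
        ((w + n) * Complex.log (w + n)).re - w.re - n := by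
      simp only [Complex.ofReal_natCast, Complex.sub_re, Complex.add_re, Complex.natCast_re]
      ring
    rw [hP0, hPn, hM, hD, hfact, h2π]
    simp only [Complex.ofReal_natCast]
    ring
  -- the bound `|L n − M − D n| ≤ B` for `n ≥ 1`, and the limit
  have hbound : ∀ᶠ n : ℕ in atTop, |Real.log ‖Complex.GammaSeq w n‖ - M - D n| ≤ B := by
    filter_upwards [eventually_ne_atTop 0] with n hn
    rw [hkey n hn, abs_neg]
    exact abs_sum_log_norm_sub_integral_le hw n
  have hlim : Tendsto (fun n : ℕ ↦ |Real.log ‖Complex.GammaSeq w n‖ - M - D n|) atTop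
      (𝓝 (|Real.log ‖Complex.Gamma w‖ - M - 0|)) :=
    ((hL.sub_const M).sub hDlim).abs
  have := le_of_tendsto hlim hbound
  simpa using this

end GammaStirling

end Literature.Analysis.SpecialFunctions
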